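import Summits.RiemannHypothesis.RiemannHypothesis.Theorems.UniversalFactorLaguerreLift
import Summits.RiemannHypothesis.RiemannHypothesis.Theorems.UniversalFactorExceptionalWideDecay
import Summits.RiemannHypothesis.RiemannHypothesis.Theorems.UniversalFactorLaplaceLoopholeConvolution
import Literature.Analysis.Complex.LaguerrePolya

/-!
# RiemannHypothesis / UniversalFactor — Laguerre's inequality and the one-point sign certificate
for the medium window

Route `RiemannHypothesis/UniversalFactor`, computation cruxes `MediumKernelNoGo`
(stmt-RiemannHypothesis-2577, `π/8 ≤ a ≤ 32`) and `LehmerPointNoGo` (stmt-RiemannHypothesis-2582,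
`a = 16`). With `F = F_a = deBruijnHDiv (1 + u²/a²)` (the Laplace(a)-smoothing of `H_0`, real entire of
order `< 2`, `F'' = a²(F − H_0)`), this file proves the REDUCTION of "`F_a` has a non-real zero" to a
finite sign pattern of real numbers at ONE real point, which certified ball arithmetic then checks:

* `UniversalFactor.laguerre_inequality` — **Laguerre's inequality, Hadamard-free**: for `f` real entire
  of order `< 2` with only real zeros, `f(x) f''(x) ≤ f'(x)²` at every real `x` (from
  `Literature.Analysis.Complex.im_mul_im_logDeriv_nonpos`: `Im (f'/f)(x + iy) ≤ 0` for `y > 0` and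
  `(f'/f)(x) ∈ ℝ`, so the derivative of `y ↦ Im (f'/f)(x + iy)` at `0`, which is `Re (f'/f)'(x)`, is `≤ 0`).
* `UniversalFactor.laguerreForm_nonneg` — for `F_a` real-rooted:
  `0 ≤ F'(x)² − a²F(x)² + a²F(x)H_0(x)` (`F'' = a²(F − H_0)`).
* `UniversalFactor.deriv_add_mul_eq_forward`, `UniversalFactor.deriv_sub_mul_eq_backward` — the one-sided
  averages: `F'(x) + aF(x) = a² ∫₀^∞ H_0(x + y) e^{−ay} dy` and
  `F'(x) − aF(x) = −a² ∫₀^∞ H_0(x − y) e^{−ay} dy` (`x ≥ 0`, from `laplaceG_eq`/`laplaceG_pos_eq`).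
* `UniversalFactor.not_hasOnlyRealZeros_of_dip_certificate` — **the certificate**: if at some `x ≥ 0`
  `H_0(x) < 0`, `∫₀^∞ H_0(x − y)e^{−ay}dy > 0` and `∫₀^∞ H_0(x + y)e^{−ay}dy > 0` (a "filled dip":
  both one-sided Laplace averages of `H_0` are positive where `H_0` itself is negative), then `F_a` has a
  non-real zero; likewise with all three signs reversed. Hence `MediumKernelNoGo` and `LehmerPointNoGo`
  follow from finitely many certified sign evaluations (`mediumKernelNoGo_of_certificates`,
  `lehmerPointNoGo_of_certificate`).

References: E. Laguerre, Œuvres I (1898) pp. 161–166 (the inequality); G. Csordas, W. Smith,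
R. S. Varga, *Lehmer pairs of zeros, the de Bruijn–Newman constant Λ, and the Riemann hypothesis*,
Constr. Approx. 10 (1994) §1 (Laguerre inequalities for real entire functions of order `< 2`); route
thesis `Theses/UniversalFactor.lean` (medium window, Lehmer pair).
-/

noncomputable section

namespace Summit.RiemannHypothesis.RiemannHypothesis.Theorems

open Complex Filter Topology MeasureTheory Set
open Literature.NumberTheory.LFunctions Literature.Analysis.Complex
open Summit.RiemannHypothesis.RiemannHypothesis.Theses

/-! ## Laguerre's inequality without Hadamard factorisation -/

/-- **Laguerre's inequality** for a real entire function `f` of order `< 2` with only real zeros: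
`f(x) f''(x) ≤ f'(x)²` for every real `x` (all three values are real). Proof without Hadamard's
factorisation: `φ = f'/f` is real at `x` and `Im φ(x + iy) ≤ 0` for `y > 0`
(`im_mul_im_logDeriv_nonpos`), so `ψ(y) = Im φ(x + iy)` has `ψ(0) = 0`, `ψ(y)/y ≤ 0`, and
`ψ'(0) = Re φ'(x) = (f f'' − f'²)/f² (x) ≤ 0`. [cite: CsordasSmithVarga1994, §1 (Laguerre inequalities)] -/
theorem UniversalFactor.laguerre_inequality {f : ℂ → ℂ} (hf : Differentiable ℂ f) {ρ C : ℝ}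
    (hρ0 : 0 ≤ ρ) (hρ : ρ < 2) (hgr : ∀ z, ‖f z‖ ≤ C * Real.exp (‖z‖ ^ ρ))
    (hreal : ∀ x : ℝ, (f x).im = 0) (hzero : ∀ z, f z = 0 → z.im = 0) (x : ℝ) :
    (f x).re * (deriv (deriv f) x).re ≤ (deriv f x).re ^ 2 := by
  have hf' : Differentiable ℂ (deriv f) := hf.deriv
  have hreal' : ∀ y : ℝ, (deriv f y).im = 0 := im_deriv_ofReal hf hreal
  have hreal'' : (deriv (deriv f) x).im = 0 := im_deriv_ofReal hf' hreal' x
  -- names for the three real values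
  set u : ℝ := (f x).re with hu
  set v : ℝ := (deriv f x).re with hv
  set w : ℝ := (deriv (deriv f) x).re with hw
  have hfu : f x = (u : ℂ) := Complex.ext (by simp [hu]) (by simp [hreal x])
  have hfv : deriv f x = (v : ℂ) := Complex.ext (by simp [hv]) (by simp [hreal' x])
  have hfw : deriv (deriv f) x = (w : ℂ) := Complex.ext (by simp [hw]) (by simp [hreal''])
  rcases eq_or_ne u 0 with h0 | h0
  · rw [h0, zero_mul]; positivity
  have hfx : f x ≠ 0 := by rw [hfu]; exact_mod_cast h0
  -- the logarithmic derivative and its derivative at `x`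
  set φ : ℂ → ℂ := fun z ↦ deriv f z / f z with hφ
  have hφd : DifferentiableAt ℂ φ x := ((hf' x).div (hf x) hfx)
  have hφ' : deriv φ x = (((w * u - v * v) / u ^ 2 : ℝ) : ℂ) := by
    rw [hφ, deriv_fun_div (hf' x) (hf x) hfx, hfu, hfv, hfw]
    push_cast
    ring
  -- `ψ(t) = Im φ(x + it)` and its derivative at `0`
  have h1 : HasDerivAt (fun s : ℂ ↦ (x : ℂ) + I * s) I ((0 : ℝ) : ℂ) := by
    simpa using ((hasDerivAt_id ((0 : ℝ) : ℂ)).const_mul I).const_add (x : ℂ)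
  have h2 : HasDerivAt (fun s : ℂ ↦ φ (x + I * s)) (deriv φ x * I) ((0 : ℝ) : ℂ) := by
    have hφx : HasDerivAt φ (deriv φ x) ((x : ℂ) + I * ((0 : ℝ) : ℂ)) := by
      simpa using hφd.hasDerivAt
    have := hφx.comp ((0 : ℝ) : ℂ) h1
    simpa [Function.comp_def] using this
  have h3 : HasDerivAt (fun t : ℝ ↦ φ (x + I * t)) (deriv φ x * I) 0 := h2.comp_ofReal
  have h4 : HasDerivAt (fun t : ℝ ↦ (φ (x + I * t)).im) ((deriv φ x * I).im) 0 := by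
    have := (Complex.imCLM.hasFDerivAt).comp_hasDerivAt (0 : ℝ) h3
    simpa [Function.comp_def] using this
  have hD : (deriv φ x * I).im = (w * u - v * v) / u ^ 2 := by
    rw [hφ', Complex.mul_im, Complex.I_re, Complex.I_im, Complex.ofReal_re, Complex.ofReal_im]
    ring
  rw [hD] at h4
  -- `ψ(0) = 0` and `ψ(t)/t ≤ 0`
  have hψ0 : (φ (x + I * (0 : ℝ))).im = 0 := by
    simp only [Complex.ofReal_zero, mul_zero, add_zero, hφ, hfu, hfv]
    rw [show ((v : ℂ) / (u : ℂ)) = ((v / u : ℝ) : ℂ) by push_cast; rfl, Complex.ofReal_im]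
  have hslope : ∀ t : ℝ, t ≠ 0 → slope (fun t : ℝ ↦ (φ (x + I * t)).im) 0 t ≤ 0 := by
    intro t ht
    rw [slope_def_field, hψ0, sub_zero, sub_zero]
    have hzim : ((x : ℂ) + I * t).im = t := by simp
    have key := im_mul_im_logDeriv_nonpos hf hρ0 hρ hgr hreal hzero (z := x + I * t)
      (by rw [hzim]; exact ht)
    rw [hzim] at key
    have : (φ (x + I * t)).im / t = t * (deriv f (x + I * t) / f (x + I * t)).im / (t * t) := by
      simp only [hφ]
      field_simp
    rw [this]
    exact div_nonpos_of_nonpos_of_nonneg key (mul_self_nonneg t)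
  have hlim := h4.tendsto_slope
  have hle : (w * u - v * v) / u ^ 2 ≤ 0 := by
    refine le_of_tendsto hlim ?_
    filter_upwards [self_mem_nhdsWithin] with t ht
    exact hslope t ht
  have hu2 : 0 < u ^ 2 := by positivity
  have : w * u - v * v ≤ 0 := by
    by_contra hcon
    push Not at hcon
    have : 0 < (w * u - v * v) / u ^ 2 := div_pos hcon hu2
    linarith
  nlinarith

/-! ## The Laguerre form of the Laplace smoothing `F_a` -/

/-- **Laguerre's inequality for `F_a`**, with `F_a'' = a²(F_a − H_0)` substituted: if `F_a` (any real
`a ≠ 0`) has only real zeros, then at every real `x`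
`0 ≤ F_a'(x)² − a² F_a(x)² + a² F_a(x) H_0(x)`. [folklore] -/
theorem UniversalFactor.laguerreForm_nonneg {a : ℝ} (ha : a ≠ 0)
    (hZ : HasOnlyRealZeros (deBruijnHDiv fun u : ℝ => 1 + u ^ 2 / a ^ 2)) (x : ℝ) :
    0 ≤ (deriv (deBruijnHDiv fun u : ℝ => 1 + u ^ 2 / a ^ 2) x).re ^ 2
      - a ^ 2 * (deBruijnHDiv (fun u : ℝ => 1 + u ^ 2 / a ^ 2) x).re ^ 2
      + a ^ 2 * ((deBruijnHDiv (fun u : ℝ => 1 + u ^ 2 / a ^ 2) x).re * (deBruijnH 0 x).re) := by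
  set F : ℂ → ℂ := deBruijnHDiv fun u : ℝ => 1 + u ^ 2 / a ^ 2 with hF
  have hFd : Differentiable ℂ F := differentiable_deBruijnHDiv_laplace a
  obtain ⟨ρ, C, hρ0, hρ, hgr⟩ := UniversalFactor.exists_growth_deBruijnHDiv_laplace a
  have hreal : ∀ y : ℝ, (F y).im = 0 := fun y ↦ deBruijnHDiv_ofReal_im _ y
  have hL := UniversalFactor.laguerre_inequality hFd hρ0 hρ hgr hreal hZ x
  have hODE : deriv (deriv F) x = (a : ℂ) ^ 2 * (F x - deBruijnH 0 x) := by
    have h : F x - deriv (deriv F) x / (a : ℂ) ^ 2 = deBruijnH 0 x :=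
      deBruijnHDiv_laplace_sub_deriv_deriv a x
    have haC : (a : ℂ) ≠ 0 := by exact_mod_cast ha
    field_simp at h
    linear_combination -h
  have hre : (deriv (deriv F) x).re = a ^ 2 * ((F x).re - (deBruijnH 0 x).re) := by
    rw [hODE, show ((a : ℂ) ^ 2) = ((a ^ 2 : ℝ) : ℂ) by push_cast; ring, Complex.re_ofReal_mul,
      Complex.sub_re]
  rw [hre] at hL
  nlinarith [hL]

/-! ## One-sided Laplace averages of `H_0` -/

/-- Shift of a half-line integral: `∫₀^∞ g(x + y) dy = ∫ₓ^∞ g(t) dt`. [folklore] -/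
theorem UniversalFactor.integral_Ioi_comp_add (g : ℝ → ℂ) (x : ℝ) :
    ∫ y in Ioi (0:ℝ), g (x + y) = ∫ t in Ioi x, g t := by
  rw [← integral_indicator measurableSet_Ioi, ← integral_indicator measurableSet_Ioi]
  have h : (Ioi (0:ℝ)).indicator (fun y => g (x + y)) = fun y => (Ioi x).indicator g (x + y) := by
    funext y
    by_cases hy : y ∈ Ioi 0
    · have hxy : x + y ∈ Ioi x := by simp only [mem_Ioi] at hy ⊢; linarith
      rw [indicator_of_mem hy, indicator_of_mem hxy]
    · have hxy : x + y ∉ Ioi x := by simp only [mem_Ioi, not_lt] at hy ⊢; linarith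
      rw [indicator_of_notMem hy, indicator_of_notMem hxy]
  rw [h]
  exact integral_add_left_eq_self ((Ioi x).indicator g) x

/-- **Forward average**: for `a > 0` and `x ≥ 0`,
`F_a'(x) + a F_a(x) = a² ∫₀^∞ H_0(x + y) e^{−ay} dy` (from `laplaceG_pos_eq`: no growing mode of
the ODE `F'' − a²F = −a²H_0`). [folklore] -/
theorem UniversalFactor.deriv_add_mul_eq_forward {a : ℝ} (ha : 0 < a) {x : ℝ} (hx : 0 ≤ x) :
    deriv (deBruijnHDiv fun u : ℝ => 1 + u ^ 2 / a ^ 2) x +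
        (a : ℂ) * deBruijnHDiv (fun u : ℝ => 1 + u ^ 2 / a ^ 2) x =
      (a : ℂ) ^ 2 * ∫ y in Ioi (0:ℝ), deBruijnH 0 ((x : ℂ) + y) * (Real.exp (-(a * y)) : ℂ) := by
  obtain ⟨-, h⟩ := UniversalFactor.laplaceG_pos_eq ha
  have h1 := h x hx
  have h2 : ∫ t in Ioi x, deBruijnH 0 t * (Real.exp (-(a * t)) : ℂ) =
      (Real.exp (-(a * x)) : ℂ) *
        ∫ y in Ioi (0:ℝ), deBruijnH 0 ((x : ℂ) + y) * (Real.exp (-(a * y)) : ℂ) := by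
    rw [← UniversalFactor.integral_Ioi_comp_add
      (fun t : ℝ => deBruijnH 0 t * (Real.exp (-(a * t)) : ℂ)) x, ← integral_const_mul]
    refine setIntegral_congr_fun measurableSet_Ioi fun y _ => ?_
    rw [show -(a * (x + y)) = -(a * x) + -(a * y) by ring, Real.exp_add]
    push_cast
    ring
  rw [h2] at h1
  have hexp : (Real.exp (-(a * x)) : ℂ) ≠ 0 := by exact_mod_cast (Real.exp_pos _).ne'
  apply mul_right_cancel₀ hexp
  rw [h1]
  ring

/-- **`F_a` is the mean of the two one-sided averages**: for `a > 0` and real `x`,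
`F_a(x) = (a/2) (∫₀^∞ H_0(x − y) e^{−ay} dy + ∫₀^∞ H_0(x + y) e^{−ay} dy)` (the convolution
`F_a = H_0 ∗ (a/2)e^{−a|·|}` of `deBruijnHDiv_laplace_eq_conv`, split at `y = 0`). [folklore] -/
theorem UniversalFactor.deBruijnHDiv_laplace_eq_half_mul_add {a : ℝ} (ha : 0 < a) (x : ℝ) :
    deBruijnHDiv (fun u : ℝ => 1 + u ^ 2 / a ^ 2) x =
      (a / 2 : ℂ) * ((∫ y in Ioi (0:ℝ), deBruijnH 0 ((x : ℂ) - y) * (Real.exp (-(a * y)) : ℂ)) +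
        ∫ y in Ioi (0:ℝ), deBruijnH 0 ((x : ℂ) + y) * (Real.exp (-(a * y)) : ℂ)) := by
  rw [deBruijnHDiv_laplace_eq_conv ha x]
  set g : ℝ → ℂ := fun y => ((a / 2 * Real.exp (-(a * |y|)) : ℝ) : ℂ) * deBruijnH 0 ((x : ℂ) - y)
    with hg
  have hint : Integrable g := integrable_laplaceKernel_mul_deBruijnH_sub ha x
  rw [← intervalIntegral.integral_Iic_add_Ioi (b := 0) hint.integrableOn hint.integrableOn]
  have hIic : ∫ y in Iic (0:ℝ), g y =
      (a / 2 : ℂ) * ∫ y in Ioi (0:ℝ), deBruijnH 0 ((x : ℂ) + y) * (Real.exp (-(a * y)) : ℂ) := by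
    have h := integral_comp_neg_Iic 0 (fun t : ℝ => g (-t))
    simp only [neg_neg, neg_zero] at h
    rw [h, ← integral_const_mul]
    refine setIntegral_congr_fun measurableSet_Ioi fun t ht => ?_
    simp only [hg, abs_neg, abs_of_pos (show (0:ℝ) < t from ht), Complex.ofReal_neg, sub_neg_eq_add]
    push_cast
    ring
  have hIoi : ∫ y in Ioi (0:ℝ), g y =
      (a / 2 : ℂ) * ∫ y in Ioi (0:ℝ), deBruijnH 0 ((x : ℂ) - y) * (Real.exp (-(a * y)) : ℂ) := by
    rw [← integral_const_mul]
    refine setIntegral_congr_fun measurableSet_Ioi fun t ht => ?_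
    simp only [hg, abs_of_pos (show (0:ℝ) < t from ht)]
    push_cast
    ring
  rw [hIic, hIoi]
  ring

/-- **Backward average**: for `a > 0` and `x ≥ 0`,
`F_a'(x) − a F_a(x) = −a² ∫₀^∞ H_0(x − y) e^{−ay} dy`. [folklore] -/
theorem UniversalFactor.deriv_sub_mul_eq_backward {a : ℝ} (ha : 0 < a) {x : ℝ} (hx : 0 ≤ x) :
    deriv (deBruijnHDiv fun u : ℝ => 1 + u ^ 2 / a ^ 2) x -
        (a : ℂ) * deBruijnHDiv (fun u : ℝ => 1 + u ^ 2 / a ^ 2) x =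
      -(a : ℂ) ^ 2 * ∫ y in Ioi (0:ℝ), deBruijnH 0 ((x : ℂ) - y) * (Real.exp (-(a * y)) : ℂ) := by
  have h1 := UniversalFactor.deriv_add_mul_eq_forward ha hx
  have h2 := UniversalFactor.deBruijnHDiv_laplace_eq_half_mul_add ha x
  linear_combination h1 - 2 * (a : ℂ) * h2

/-! ## The one-point certificate -/

/-- **The Laguerre one-point certificate.** Let `a > 0`, `x ≥ 0`, and put `H = H_0(x)`,
`P = ∫₀^∞ H_0(x − y) e^{−ay} dy`, `Q = ∫₀^∞ H_0(x + y) e^{−ay} dy` (real numbers). Then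
`F_a = (a/2)(P + Q)`, `F_a' = (a²/2)(Q − P)`, `F_a'' = a²(F_a − H_0)` at `x`, and the Laguerre form is
`F'² − FF'' = −a⁴PQ + (a³/2)(P + Q)H`; so if `(P + Q)·H < 2a·PQ` then the Laguerre form is negative
at `x` and `F_a` has a non-real zero. [folklore] -/
theorem UniversalFactor.not_hasOnlyRealZeros_of_laguerre_certificate {a : ℝ} (ha : 0 < a) {x : ℝ}
    (hx : 0 ≤ x)
    (hcert : ((∫ y in Ioi (0:ℝ), deBruijnH 0 ((x : ℂ) - y) * (Real.exp (-(a * y)) : ℂ)).re +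
          (∫ y in Ioi (0:ℝ), deBruijnH 0 ((x : ℂ) + y) * (Real.exp (-(a * y)) : ℂ)).re) *
          (deBruijnH 0 x).re <
        2 * a * ((∫ y in Ioi (0:ℝ), deBruijnH 0 ((x : ℂ) - y) * (Real.exp (-(a * y)) : ℂ)).re *
          (∫ y in Ioi (0:ℝ), deBruijnH 0 ((x : ℂ) + y) * (Real.exp (-(a * y)) : ℂ)).re)) :
    ¬ HasOnlyRealZeros (deBruijnHDiv fun u : ℝ => 1 + u ^ 2 / a ^ 2) := by
  intro hZ
  set F : ℂ → ℂ := deBruijnHDiv fun u : ℝ => 1 + u ^ 2 / a ^ 2 with hF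
  set P : ℝ := (∫ y in Ioi (0:ℝ), deBruijnH 0 ((x : ℂ) - y) * (Real.exp (-(a * y)) : ℂ)).re with hP
  set Q : ℝ := (∫ y in Ioi (0:ℝ), deBruijnH 0 ((x : ℂ) + y) * (Real.exp (-(a * y)) : ℂ)).re with hQ
  have hL := UniversalFactor.laguerreForm_nonneg ha.ne' hZ x
  have hfwd := congrArg Complex.re (UniversalFactor.deriv_add_mul_eq_forward ha hx)
  have hmean := congrArg Complex.re (UniversalFactor.deBruijnHDiv_laplace_eq_half_mul_add ha x)
  simp only [Complex.add_re, Complex.re_ofReal_mul] at hfwd hmean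
  rw [show ((a : ℂ) ^ 2) = ((a ^ 2 : ℝ) : ℂ) by push_cast; ring, Complex.re_ofReal_mul] at hfwd
  rw [show ((a / 2 : ℂ)) = ((a / 2 : ℝ) : ℂ) by push_cast; ring, Complex.re_ofReal_mul,
    Complex.add_re] at hmean
  rw [← hQ] at hfwd
  rw [← hP, ← hQ] at hmean
  -- the Laguerre form equals `−a⁴PQ + (a³/2)(P+Q)H`
  have hform : (deriv F x).re ^ 2 - a ^ 2 * (F x).re ^ 2 + a ^ 2 * ((F x).re * (deBruijnH 0 x).re) =
      -a ^ 4 * (P * Q) + a ^ 3 / 2 * ((P + Q) * (deBruijnH 0 x).re) := by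
    have h1 : (deriv F x).re = a ^ 2 * Q - a * (F x).re := by linarith
    rw [h1, hmean]
    ring
  rw [hform] at hL
  have ha3 : 0 < a ^ 3 := by positivity
  nlinarith [mul_lt_mul_of_pos_left hcert ha3]

/-- **Filled-dip certificate** (the shape used at Lehmer's pair, `x ≈ 14010.16`): `H_0(x) < 0` while
both one-sided Laplace averages of `H_0` at `x` are positive `⇒` `F_a` has a non-real zero.
[folklore] -/
theorem UniversalFactor.not_hasOnlyRealZeros_of_dip_certificate {a : ℝ} (ha : 0 < a) {x : ℝ}
    (hx : 0 ≤ x) (hH : (deBruijnH 0 x).re < 0)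
    (hP : 0 < (∫ y in Ioi (0:ℝ), deBruijnH 0 ((x : ℂ) - y) * (Real.exp (-(a * y)) : ℂ)).re)
    (hQ : 0 < (∫ y in Ioi (0:ℝ), deBruijnH 0 ((x : ℂ) + y) * (Real.exp (-(a * y)) : ℂ)).re) :
    ¬ HasOnlyRealZeros (deBruijnHDiv fun u : ℝ => 1 + u ^ 2 / a ^ 2) := by
  refine UniversalFactor.not_hasOnlyRealZeros_of_laguerre_certificate ha hx ?_
  have h1 : 0 < 2 * a * ((∫ y in Ioi (0:ℝ), deBruijnH 0 ((x : ℂ) - y) * (Real.exp (-(a * y)) : ℂ)).re *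
      (∫ y in Ioi (0:ℝ), deBruijnH 0 ((x : ℂ) + y) * (Real.exp (-(a * y)) : ℂ)).re) := by positivity
  nlinarith [mul_pos (add_pos hP hQ) (neg_pos.2 hH)]

/-- **Hump certificate** (all signs reversed): `H_0(x) > 0` while both one-sided Laplace averages of
`H_0` at `x` are negative `⇒` `F_a` has a non-real zero. [folklore] -/
theorem UniversalFactor.not_hasOnlyRealZeros_of_hump_certificate {a : ℝ} (ha : 0 < a) {x : ℝ}
    (hx : 0 ≤ x) (hH : 0 < (deBruijnH 0 x).re)
    (hP : (∫ y in Ioi (0:ℝ), deBruijnH 0 ((x : ℂ) - y) * (Real.exp (-(a * y)) : ℂ)).re < 0)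
    (hQ : (∫ y in Ioi (0:ℝ), deBruijnH 0 ((x : ℂ) + y) * (Real.exp (-(a * y)) : ℂ)).re < 0) :
    ¬ HasOnlyRealZeros (deBruijnHDiv fun u : ℝ => 1 + u ^ 2 / a ^ 2) := by
  refine UniversalFactor.not_hasOnlyRealZeros_of_laguerre_certificate ha hx ?_
  have h1 : 0 < 2 * a * ((∫ y in Ioi (0:ℝ), deBruijnH 0 ((x : ℂ) - y) * (Real.exp (-(a * y)) : ℂ)).re *
      (∫ y in Ioi (0:ℝ), deBruijnH 0 ((x : ℂ) + y) * (Real.exp (-(a * y)) : ℂ)).re) := by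
    have := mul_pos_of_neg_of_neg hP hQ
    positivity
  nlinarith [mul_neg_of_neg_of_pos (add_neg hP hQ) hH]

/-! ## The cruxes as finite sign checks -/

/-- **`MediumKernelNoGo` from certificates**: if for every `a ∈ [π/8, 32]` some real point `x ≥ 0`
carries a Laguerre certificate `(P + Q)·H_0(x) < 2a·PQ` for the one-sided Laplace(a) averages `P, Q`
of `H_0` at `x`, then every `F_a` of the medium window has a non-real zero (route
`UniversalFactor`, item stmt-RiemannHypothesis-2577; the hypothesis is what the certified
ball-arithmetic computation attached to the item establishes on a finite cover of `[π/8, 32]` by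
`a`-intervals). [folklore] -/
theorem UniversalFactor.mediumKernelNoGo_of_certificates
    (h : ∀ a : ℝ, Real.pi / 8 ≤ a → a ≤ 32 → ∃ x : ℝ, 0 ≤ x ∧
      ((∫ y in Ioi (0:ℝ), deBruijnH 0 ((x : ℂ) - y) * (Real.exp (-(a * y)) : ℂ)).re +
          (∫ y in Ioi (0:ℝ), deBruijnH 0 ((x : ℂ) + y) * (Real.exp (-(a * y)) : ℂ)).re) *
          (deBruijnH 0 x).re <
        2 * a * ((∫ y in Ioi (0:ℝ), deBruijnH 0 ((x : ℂ) - y) * (Real.exp (-(a * y)) : ℂ)).re *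
          (∫ y in Ioi (0:ℝ), deBruijnH 0 ((x : ℂ) + y) * (Real.exp (-(a * y)) : ℂ)).re)) :
    UniversalFactor.MediumKernelNoGo := by
  intro a ha h32
  have ha0 : 0 < a := lt_of_lt_of_le (by positivity) ha
  obtain ⟨x, hx, hc⟩ := h a ha h32
  exact UniversalFactor.not_hasOnlyRealZeros_of_laguerre_certificate ha0 hx hc

/-- **`LehmerPointNoGo` from one certificate** (`a = 16`, item stmt-RiemannHypothesis-2582): a single
point `x ≥ 0` with `(P + Q)·H_0(x) < 32·PQ` for the Laplace(16) one-sided averages shows that `F_16`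
has a non-real zero (numerically `x = 14010.163`, the midpoint of Lehmer's pair, is such a point:
`H_0 < 0 < P, Q`). [folklore] -/
theorem UniversalFactor.lehmerPointNoGo_of_certificate
    (h : ∃ x : ℝ, 0 ≤ x ∧
      ((∫ y in Ioi (0:ℝ), deBruijnH 0 ((x : ℂ) - y) * (Real.exp (-(16 * y)) : ℂ)).re +
          (∫ y in Ioi (0:ℝ), deBruijnH 0 ((x : ℂ) + y) * (Real.exp (-(16 * y)) : ℂ)).re) *
          (deBruijnH 0 x).re <
        2 * 16 * ((∫ y in Ioi (0:ℝ), deBruijnH 0 ((x : ℂ) - y) * (Real.exp (-(16 * y)) : ℂ)).re *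
          (∫ y in Ioi (0:ℝ), deBruijnH 0 ((x : ℂ) + y) * (Real.exp (-(16 * y)) : ℂ)).re)) :
    UniversalFactor.LehmerPointNoGo := by
  obtain ⟨x, hx, hc⟩ := h
  exact UniversalFactor.not_hasOnlyRealZeros_of_laguerre_certificate (a := 16) (by norm_num) hx hc

/-! ## The analytic input of the certificate's tail bounds: `|H_0(x)| ≤ H_0(0)` on the real axis -/

/-- `Φ` is integrable on `(0, ∞)` (as a real function). [folklore] -/
theorem UniversalFactor.integrableOn_deBruijnPhi : IntegrableOn deBruijnPhi (Ioi (0:ℝ)) := by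
  have h : IntegrableOn (fun u : ℝ => RCLike.re (((deBruijnPhi u : ℝ) : ℂ) * Complex.cos (0 * u))) (Ioi 0) :=
    (integrableOn_deBruijnPhi_mul_cos 0).re
  refine h.congr_fun (fun u _ => ?_) measurableSet_Ioi
  simp

/-- `H_0(0) = ∫₀^∞ Φ(u) du` (a positive real number). [folklore] -/
theorem UniversalFactor.deBruijnH_zero_apply_zero :
    deBruijnH 0 0 = ((∫ u in Ioi (0:ℝ), deBruijnPhi u : ℝ) : ℂ) := by
  rw [deBruijnH_zero_eq_integral_cos 0, ← integral_complex_ofReal]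
  refine setIntegral_congr_fun measurableSet_Ioi fun u _ => ?_
  simp

/-- **The real-axis supremum of `H_0` is `H_0(0)`**: `‖H_0(x)‖ ≤ H_0(0) = ∫₀^∞ Φ` for every real `x`,
because `H_0(x) = ∫₀^∞ Φ(u) cos(xu) du` with `Φ > 0` and `|cos| ≤ 1`. (This is the only bound on `Ξ`
that the certified computation for `MediumKernelNoGo` uses, for the far tails of the one-sided
averages.) [folklore] -/
theorem UniversalFactor.norm_deBruijnH_zero_ofReal_le (x : ℝ) :
    ‖deBruijnH 0 x‖ ≤ (deBruijnH 0 0).re := by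
  rw [UniversalFactor.deBruijnH_zero_apply_zero, Complex.ofReal_re, deBruijnH_zero_eq_integral_cos x]
  refine norm_integral_le_of_norm_le UniversalFactor.integrableOn_deBruijnPhi
    (ae_restrict_of_forall_mem measurableSet_Ioi fun u hu => ?_)
  rw [norm_mul, Complex.norm_real, Real.norm_eq_abs, abs_of_pos (deBruijnPhi_pos_of_nonneg (le_of_lt hu)),
    show (x : ℂ) * (u : ℂ) = ((x * u : ℝ) : ℂ) by push_cast; ring, ← Complex.ofReal_cos, Complex.norm_real,
    Real.norm_eq_abs]
  exact mul_le_of_le_one_right (deBruijnPhi_pos_of_nonneg (le_of_lt hu)).le (Real.abs_cos_le_one _)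

/-- `0 < H_0(0)`. [folklore] -/
theorem UniversalFactor.deBruijnH_zero_apply_zero_pos : 0 < (deBruijnH 0 0).re := by
  rw [UniversalFactor.deBruijnH_zero_apply_zero, Complex.ofReal_re]
  refine (setIntegral_pos_iff_support_of_nonneg_ae
    (ae_restrict_of_forall_mem measurableSet_Ioi fun u hu => (deBruijnPhi_pos_of_nonneg (le_of_lt hu)).le)
    UniversalFactor.integrableOn_deBruijnPhi).2 ?_
  have hs : Function.support deBruijnPhi ∩ Ioi 0 = Ioi 0 := by
    ext u
    simp only [mem_inter_iff, Function.mem_support, mem_Ioi]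
    exact ⟨And.right, fun hu => ⟨(deBruijnPhi_pos_of_nonneg hu.le).ne', hu⟩⟩
  rw [hs, Real.volume_Ioi]
  exact ENNReal.zero_lt_top

end Summit.RiemannHypothesis.RiemannHypothesis.Theorems
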